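import Literature.AnabelianGeometry.EtaleTheta.SettingModelChiYCoordKit
import Literature.AnabelianGeometry.EtaleTheta.SettingModelChiKummerDataCusp
import Literature.AnabelianGeometry.EtaleTheta.Discharge.Sec1Rmk131ModelTate
import Literature.AnabelianGeometry.EtaleTheta.SettingModelTateZClass
import Literature.AnabelianGeometry.EtaleTheta.SettingModelTateThetaCusp
import HarnessLib

/-!
# The `y`-coordinate kit of [EtTh] §1 (Prop. 1.5) at the two CUSPED model settings `modelχ′` and `modelχq′`
# (R78 cluster, row «KIT-CUSP»): `ThetaSetting.YCoordKit` inhabited at a setting with `IsEtThOrigin` AND a cusp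

S. Mochizuki, *The étale theta function and its Frobenioid-theoretic manifestations*, Publ. RIMS **45** (2009)
[EtTh], §1, Prop. 1.5 (i)(ii) p. 23 ("`F¹/F² = Ẑ·log(U)`", "`log(Ü) = ½·log(U)`")
[cite: MochizukiEtTh2009, Prop 1.5 p.23]. Layer L2 of the abc-iut cell, seat abc-iut-w5-d171 (gen 4; the
`ThetaSetting.YCoordKit` author lineage, `KummerDataYCoord.lean` p436377), abc-iut-L2-lead (gen 4) ROWS #18 R318
«YCOORDKIT NV @ a §1 model» — at the two models of record the kit is ALREADY in the tree (`yCoordKitχ`,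
abc-iut-w5-d181 p439660; `yCoordKitχq`, this lineage p439251, hence at `modelTate := modelχq p 1 2` by `rfl`);
THIS FILE supplies the two remaining constructor sites, the CUSPED twins of abc-iut-w5-d029 (`ThetaSetting.modelχ′`,
F5c `SettingModelChiThetaCusp`; `ThetaSetting.modelχq′`, F5qc `SettingModelTateThetaCusp`). Both cusped records
share with their uncusped twins the carrier `Π^tp_X`, the augmentation, `toZ`, the coverings and — definitionally,
`thetaKer_curveχ'_eq` / `thetaKer_curveχq'_eq` — the theta quotient with its centre `Δ_Θ`; they differ only in
the cusp datum. Hence the kits transport FIELD BY FIELD (the pattern of this lineage's `kummerCoreχ′`, p435106,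
and of abc-iut-w5-d181's `kummerCoreχq′`), and every generic consequence of `KummerDataYCoord` /
`KummerDataYCoordFiltration` (abc-iut-w5-d181) applies verbatim (at stage 2 through abc-iut-f-117's built witnesses
`toTheta_inl_b_mem_gtpY_map_modelχq` / `conjNormal_toTheta_inl_b_modelχq` / `yCoordKitχq_y_inl_b` /
`yCoordKitχq_iota_bijective` of `Discharge/Sec1Rmk131ModelTate`, since abc-iut-w5-d181's model-level
`SettingModelTateKummerDataFiltration` is accepted but not yet served as an olean at the time of writing). Class (b) constructions over the frozen interface:
two `def`s (`yCoordKitχ'`, `yCoordKitχq'`), no instance, no notation, no `Prop` fact; nothing restated.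

RESULTS. `yCoordKitχ'` with `rfl` identities onto the F6c classes (`(yCoordKitχ' p).logU = (kummerDataχ′ p).logU`,
`… .logUdd = (kummerDataχ′ p).logUdd`), the filtration facts `log(U) ∉ F²`, `log(U)^ℤ ∩ F² = 1`, `log(Ü) ∉ F̈²`,
`log(U)|_{Δ_Θ} = 1` at `modelχ′`; `yCoordKitχq'` with `rfl` identities onto `yCoordKitχq`, `ι` injective,
`ŷ(b^t) = t`, `log(U) ≠ 1`, `log(U)|_{Δ_Θ} = 1` at `modelχq′`; census forms
`exists_isEtThOrigin_and_isCusp_and_nonempty_yCoordKit` (stage 1) and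
`exists_isEtThOrigin_and_isCusp_and_nonempty_yCoordKit_stage2`.

HONEST FRAMING: SEMI-SYNTHETIC models (the χ-twisted root with a cusp; its Tate-sheared stage-2 twin) —
consistency / non-vacuity evidence for the typed interface ONLY; nothing of [EtTh] is asserted; typed ≠ proved;
no side is taken on [IUTchIII] Cor. 3.12.
-/

noncomputable section

namespace Literature.AnabelianGeometry.EtaleTheta.SettingModel

open Literature.AnabelianGeometry.SemiGraphs

variable (p : ℕ) [Fact p.Prime]

/-! ### Stage 1: the cusped χ-model `modelχ′` -/

/-- **The `y`-coordinate kit of the cusped χ-twisted root model** — field by field the kit of `modelχ` (same theta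
quotient, same `Δ_Θ`-coordinates `ι = deltaThetaCoordχ`, same `ŷ = yThetaχ`, same `χ^Θ = χ ∘ aug^Θ`).
[cite: MochizukiEtTh2009, Prop 1.5 p.23] -/
def yCoordKitχ' : (ThetaSetting.modelχ' p).YCoordKit where
  chiT := (yCoordKitχ p).chiT
  iota := (yCoordKitχ p).iota
  continuous_iota := (yCoordKitχ p).continuous_iota
  iota_chiT := (yCoordKitχ p).iota_chiT
  y := (yCoordKitχ p).y
  continuous_y := (yCoordKitχ p).continuous_y
  y_mul := (yCoordKitχ p).y_mul
  y_even := (yCoordKitχ p).y_even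

/-- The cusped kit's `ŷ` is `yThetaχ` (definitionally). [cite: MochizukiEtTh2009, Prop 1.5 p.23] -/
theorem yCoordKitχ'_y : (yCoordKitχ' p).y = yThetaχ p := rfl

/-- The cusped kit's `ι` is `deltaThetaCoordχ` (definitionally). [cite: MochizukiEtTh2009, §1 p.12] -/
theorem yCoordKitχ'_iota : (yCoordKitχ' p).iota = deltaThetaCoordχ p := rfl

/-- **Its `log(U)` IS the class `logUχ`, i.e. the `log(U)` of the cusped Kummer datum `kummerDataχ′`** (definitionally).
[cite: MochizukiEtTh2009, Prop 1.5 p.23] -/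
theorem yCoordKitχ'_logU : (yCoordKitχ' p).logU = (kummerDataχ' p).logU := rfl

/-- **Its `log(Ü)` IS the `log(Ü)` of `kummerDataχ′`** (definitionally). [cite: MochizukiEtTh2009, Prop 1.5 p.23] -/
theorem yCoordKitχ'_logUdd : (yCoordKitχ' p).logUdd = (kummerDataχ' p).logUdd := rfl

/-- … and coincides with the uncusped kit's class (same carrier). [cite: MochizukiEtTh2009, Prop 1.5 p.23] -/
theorem yCoordKitχ'_logU_eq : (yCoordKitχ' p).logU = (yCoordKitχ p).logU := rfl

/-- The cusped Kummer data ARE the Kummer data of the cusped core (definitionally). [cite: MochizukiEtTh2009, Prop 1.5 p.23] -/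
theorem kummerDataχ'_eq_toKummerData : kummerDataχ' p = (kummerCoreχ' p).toKummerData := rfl

/-- The cusped kit's `ι` is injective (`Ẑ ⥲ Δ_Θ`). [cite: MochizukiEtTh2009, §1 p.12] -/
theorem yCoordKitχ'_iota_injective : Function.Injective (yCoordKitχ' p).iota := yCoordKitχ_iota_injective p

/-- `ŷ(b^t) = t` at the cusped model. [cite: MochizukiEtTh2009, Prop 1.5 p.23] -/
theorem yCoordKitχ'_y_inl_bPowGfp (t : ZH) :
    (yCoordKitχ' p).y (CurveTheta.toTheta (curveχ' p) (SemidirectProduct.inl (bPowGfp t))) = t :=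
  yCoordKitχ_y_inl_bPowGfp p t

/-- **`log(U) ∉ F²`** at the cusped χ-model (generic `YCoordKit.logU_not_mem_range_kumY` at `h := θ(inl b)`).
[cite: MochizukiEtTh2009, Prop 1.5 p.23] -/
theorem yCoordKitχ'_logU_not_mem_range_kumY :
    (yCoordKitχ' p).logU ∉ Set.range (kummerDataχ' p).kumY :=
  yCoordKitχ_logU_not_mem_range_kumY p

/-- **`log(U)^ℤ ∩ F² = 1`** at the cusped χ-model. [cite: MochizukiEtTh2009, Prop 1.5 p.23] -/
theorem yCoordKitχ'_zpowers_logU_inf_range_kumY :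
    Subgroup.zpowers (yCoordKitχ' p).logU ⊓ (kummerDataχ' p).kumY.range = ⊥ :=
  yCoordKitχ_zpowers_logU_inf_range_kumY p

/-- **`log(Ü) ∉ F̈²`** at the cusped χ-model. [cite: MochizukiEtTh2009, Prop 1.5 p.23] -/
theorem yCoordKitχ'_logUdd_not_mem_range_kumYdd :
    (yCoordKitχ' p).logUdd ∉ Set.range (kummerDataχ' p).kumYdd :=
  yCoordKitχ_logUdd_not_mem_range_kumYdd p

/-- **`log(U) ∈ F¹`** (`log(U)|_{Δ_Θ} = 1`) at the cusped χ-model. [cite: MochizukiEtTh2009, Prop 1.5 p.23] -/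
theorem yCoordKitχ'_res_deltaTheta_logU :
    ContH1.res (MonoidHom.id (ThetaSetting.modelχ' p).GtpTheta) (ThetaSetting.modelχ' p).DeltaTheta
      (deltaTheta_le_gtpY_map_modelχ p) (yCoordKitχ' p).logU = 1 :=
  yCoordKitχ_res_deltaTheta_logU p

/-- **`log(U) ≠ 1`** at the cusped χ-model (the criterion `YCoordKit.logU_ne_one` at `b`).
[cite: MochizukiEtTh2009, Prop 1.5 p.23] -/
theorem yCoordKitχ'_logU_ne_one : (yCoordKitχ' p).logU ≠ 1 := logUχ_ne_one p

/-- CENSUS (stage 1): the kit interface is inhabited at a setting with `IsEtThOrigin` AND a cusp.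
[cite: MochizukiEtTh2009, Prop 1.5 p.23] -/
theorem _root_.Literature.AnabelianGeometry.EtaleTheta.ThetaSetting.exists_isEtThOrigin_and_isCusp_and_nonempty_yCoordKit :
    ∃ D : ThetaSetting p, D.IsEtThOrigin ∧ (∃ x : D.Pt, D.IsCusp x) ∧ Nonempty D.YCoordKit :=
  ⟨ThetaSetting.modelχ' p, ThetaSetting.modelχ'_isEtThOrigin p, exists_isCusp_modelχ' p, ⟨yCoordKitχ' p⟩⟩

/-! ### Stage 2: the cusped Tate-sheared model `modelχq′` -/

section stage2

variable (i j : ℤ) (hj : Even j)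

/-- **The `y`-coordinate kit of the cusped stage-2 model `modelχq′ p i j`** — field by field the kit of `modelχq p i j`
(same theta quotient `thetaKer_curveχq'_eq`, same `ι = deltaThetaCoordχq`, same `ŷ = yThetaχq`).
[cite: MochizukiEtTh2009, Prop 1.5 p.23] -/
def yCoordKitχq' : (ThetaSetting.modelχq' p i j hj).YCoordKit where
  chiT := (yCoordKitχq p i j hj).chiT
  iota := (yCoordKitχq p i j hj).iota
  continuous_iota := (yCoordKitχq p i j hj).continuous_iota
  iota_chiT := (yCoordKitχq p i j hj).iota_chiT
  y := (yCoordKitχq p i j hj).y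
  continuous_y := (yCoordKitχq p i j hj).continuous_y
  y_mul := (yCoordKitχq p i j hj).y_mul
  y_even := (yCoordKitχq p i j hj).y_even

/-- The cusped stage-2 kit's `ŷ` is `yThetaχq` (definitionally). [cite: MochizukiEtTh2009, Prop 1.5 p.23] -/
theorem yCoordKitχq'_y : (yCoordKitχq' p i j hj).y = yThetaχq p i j := rfl

/-- The cusped stage-2 kit's `ι` is `deltaThetaCoordχq` (definitionally). [cite: MochizukiEtTh2009, §1 p.12] -/
theorem yCoordKitχq'_iota : (yCoordKitχq' p i j hj).iota = deltaThetaCoordχq p i j := rfl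

/-- **Its `log(U)` IS the stage-2 class** `(yCoordKitχq p i j hj).logU = (kummerDataχq p i j hj).logU` (definitionally).
[cite: MochizukiEtTh2009, Prop 1.5 p.23] -/
theorem yCoordKitχq'_logU : (yCoordKitχq' p i j hj).logU = (kummerDataχq p i j hj).logU := rfl

/-- **Its `log(Ü)` IS the stage-2 `log(Ü)`** (definitionally). [cite: MochizukiEtTh2009, Prop 1.5 p.23] -/
theorem yCoordKitχq'_logUdd : (yCoordKitχq' p i j hj).logUdd = (kummerDataχq p i j hj).logUdd := rfl

/-- The cusped stage-2 kit's `ι` is injective. [cite: MochizukiEtTh2009, §1 p.12] -/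
theorem yCoordKitχq'_iota_injective : Function.Injective (yCoordKitχq' p i j hj).iota :=
  (yCoordKitχq_iota_bijective p i j hj).1

/-- `ŷ(b^t) = t` at the cusped stage-2 model. [cite: MochizukiEtTh2009, Prop 1.5 p.23] -/
theorem yCoordKitχq'_y_inl_bPowGfp (t : ZH) :
    (yCoordKitχq' p i j hj).y (CurveTheta.toTheta (curveχq' p i j) (SemidirectProduct.inl (bPowGfp t))) = t := by
  show yThetaχq p i j (CurveTheta.toTheta (curveχq p i j) _) = t
  rw [yThetaχq_toTheta, yCoordχq_inl_bPowGfp]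

/-- `ŷ` vanishes on `Δ_Θ = c^Ẑ` at the cusped stage-2 model. [cite: MochizukiEtTh2009, Prop 1.5 p.23] -/
theorem yCoordKitχq'_y_eq_one_of_mem_deltaTheta (d : (ThetaSetting.modelχq' p i j hj).GtpTheta)
    (hd : d ∈ (ThetaSetting.modelχq' p i j hj).DeltaTheta) : (yCoordKitχq' p i j hj).y d = 1 :=
  yThetaχq_eq_one_of_mem_deltaTheta p i j hd

/-- **`log(U) ≠ 1`** at the cusped stage-2 model. [cite: MochizukiEtTh2009, Prop 1.5 p.23] -/
theorem yCoordKitχq'_logU_ne_one : (yCoordKitχq' p i j hj).logU ≠ 1 := kummerDataχq_logU_ne_one p i j hj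

/-- **`log(U) ∉ F²`** at the cusped stage-2 model, relative to the stage-2 core's Kummer map (the cusped core of
abc-iut-w5-d181's `SettingModelTateKummerDataCusp` is field by field the same map). [cite: MochizukiEtTh2009, Prop 1.5 p.23] -/
theorem yCoordKitχq'_logU_not_mem_range_kumY :
    (yCoordKitχq' p i j hj).logU ∉ Set.range (kummerDataχq p i j hj).kumY :=
  (yCoordKitχq p i j hj).logU_not_mem_range_kumY (kummerCoreχq p i j hj) (yCoordKitχq_iota_bijective p i j hj).1
    (toTheta_inl_b_mem_gtpY_map_modelχq p i j hj) (augTheta_kummerCoreχq_inl_b p i j hj)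
    (conjNormal_toTheta_inl_b_modelχq p i j hj)
    (by rw [yCoordKitχq_y_inl_b]; exact iotaZ_ofAdd_ne_one one_ne_zero)

/-- **`log(U) ∈ F¹`** (`log(U)|_{Δ_Θ} = 1`) at the cusped stage-2 model. [cite: MochizukiEtTh2009, Prop 1.5 p.23] -/
theorem yCoordKitχq'_res_deltaTheta_logU :
    haveI : (ThetaSetting.modelχq' p i j hj).DeltaTheta.Normal := ThetaSetting.deltaTheta_normal _
    haveI : IsMulCommutative (ThetaSetting.modelχq' p i j hj).DeltaTheta := ThetaSetting.deltaTheta_comm _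
    ContH1.res (MonoidHom.id (ThetaSetting.modelχq' p i j hj).GtpTheta) (ThetaSetting.modelχq' p i j hj).DeltaTheta
      ((ThetaSetting.modelχq' p i j hj).compat.deltaTheta_le_DtpYTheta.trans (Subgroup.map_mono inf_le_left))
      (yCoordKitχq' p i j hj).logU = 1 :=
  (yCoordKitχq' p i j hj).res_deltaTheta_logU _ (yCoordKitχq'_y_eq_one_of_mem_deltaTheta p i j hj)

include i j hj in
/-- CENSUS (stage 2): the kit interface is inhabited at a Tate-sheared setting with `IsEtThOrigin` AND a cusp, with
`log(U) ≠ 1`. [cite: MochizukiEtTh2009, Prop 1.5 p.23] -/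
theorem _root_.Literature.AnabelianGeometry.EtaleTheta.ThetaSetting.exists_isEtThOrigin_and_isCusp_and_nonempty_yCoordKit_stage2 :
    ∃ D : ThetaSetting p, D.IsEtThOrigin ∧ (∃ x : D.Pt, D.IsCusp x) ∧ ∃ K : D.YCoordKit, K.logU ≠ 1 :=
  ⟨ThetaSetting.modelχq' p i j hj, ThetaSetting.modelχq'_isEtThOrigin p i j hj, exists_isCusp_modelχq' p i j hj,
    yCoordKitχq' p i j hj, yCoordKitχq'_logU_ne_one p i j hj⟩

end stage2

end Literature.AnabelianGeometry.EtaleTheta.SettingModel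

end
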